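import Summits.FinalStateConjecture.FinalStateConjecture.Theorems.ZeroEnergyRigidity.Negative.MinkowskiNoHorizon
import Summits.FinalStateConjecture.FinalStateConjecture.Theorems.ZeroEnergyRigidity.Negative.MinkowskiIPlusRegular
import Literature.Geometry.Lorentzian.StationaryBlackHoleUniqueness
import Literature.Geometry.Lorentzian.CausalityOpennessProofs
import Literature.Geometry.Lorentzian.LorentzianMetricProofs
import Literature.Geometry.Lorentzian.CauchyProblemCauchy

/-!
# Connectedness of the horizon is load-bearing in the uniqueness schemas over `StationaryAFBlackHole`

Negative lane of the crux `ZeroEnergyRigidity` (stmt-FinalStateConjecture-10690), cdisprove cycle 4.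
The Minkowski presentation `minkowskiBH` (`MinkowskiPresentation.lean`: empty future event horizon,
`doc = ℝ⁴`) is `I⁺`-regular and analytic (`MinkowskiIPlusRegular.lean`), vacuum, and its horizon is
(vacuously) non-degenerate — yet its d.o.c. is NOT a sub-extremal Kerr exterior
(`MinkowskiNoHorizon.lean`, via Sbierski).  Consequently:

* `not_aik_regular_analytic_nondegenerate`: the Alexakis–Ionescu–Klainerman schema
  `AlexakisIonescuKlainermanRigidity P` of `BlackHoles.lean` is FALSE at the predicate
  `P 𝓑 = IsIPlusRegular 𝓑 ∧ IsAnalytic 𝓑 ∧ IsNonDegenerateHorizon 𝓑` — i.e. the vendored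
  Chruściel–Costa 2008 Thm. 1.3 schema `stationary_black_hole_uniqueness IsIPlusRegular` with its
  hypothesis `IsConnected 𝓑.horizon` deleted (`not_uniqueness_without_connected_horizon`);
* `not_aik_isIPlusRegular`: a fortiori the schema at the bare predicate `IsIPlusRegular` is false
  (the docstring of `StationaryBlackHoleUniqueness.lean` asserts this informally; here it is a theorem).

For the crux: every restate of `ZeroEnergyRigidity` in the `I⁺`-regular vocabulary (lines
`global-horizon-killing-field`, `osculating-frontier-induction`, the planned collar-h3 restate) must
keep a NON-EMPTINESS clause on `𝓔⁺` (`IsConnected 𝓑.horizon`, as `IsIPlusRegularNonDegenerate`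
does); `IsNonDegenerateHorizon`, `I⁺`-regularity, analyticity and vacuum together do not supply it,
because the typed conclusion (`Kerr.IsSubextremal M a`, hence `M > 0`) excludes Minkowski space.

References: P. T. Chruściel, J. L. Costa, Astérisque 321 (2008), Def. 1.1, Thm. 1.3;
S. Alexakis, A. D. Ionescu, S. Klainerman, CMP 299 (2010), Main Theorem; J. Sbierski, JDG 108 (2018).
-/

noncomputable section

namespace Summit.FinalStateConjecture.FinalStateConjecture.Theorems.ZeroEnergyRigidity.Negative

open Set Function Literature.Geometry.Lorentzian
open scoped Manifold ContDiff Topology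

/-- **Kerr chart transfer** (copy of the Disproof's kernel-checked (T5), kept here so that the
negative lane does not depend on a work file): the vendored conclusion
`IsIsometricToKerrExterior hF hP hres` (a diffeomorphism `Φ` of the open submanifold `⟨⟨M_ext⟩⟩`
onto `Kerr.exterior M a`, an isometry of the restricted metric) yields the fact-free chart form of the
crux conclusion, with `Ψ := Subtype.val ∘ Φ.symm`. [folklore] -/
theorem kerrConclusion_of_isIsometricToKerrExterior (𝓑₁ : StationaryAFBlackHole.{0}) [Kerr.Facts]
    (hF : 𝓑₁.metric.isOpen_chronologicalFuture 𝓑₁.timeOrientation)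
    (hP : 𝓑₁.metric.isOpen_chronologicalPast 𝓑₁.timeOrientation)
    (hres : PseudoRiemannianMetric.contMDiff_restrict (I := 𝓡 4) (n := (∞ : ℕ∞ω))
      (M := 𝓑₁.carrier))
    (h : 𝓑₁.IsIsometricToKerrExterior hF hP hres) :
    ∃ (M a : ℝ), Kerr.IsSubextremal M a ∧ ∃ Ψ : Kerr.exterior M a → 𝓑₁.carrier,
      Function.Injective Ψ ∧ Set.range Ψ = 𝓑₁.doc ∧
        PseudoRiemannianMetric.IsIsometricImmersion
          (Kerr.smoothMetric M a (Kerr.rPlus M a)).toPseudoRiemannianMetric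
          𝓑₁.metric.toPseudoRiemannianMetric Ψ := by
  obtain ⟨M, a, hMa, Φ, hΦ⟩ := h
  have hincl : PseudoRiemannianMetric.IsIsometricImmersion
      (𝓑₁.metric.restrict hres (𝓑₁.docOpens hF hP)).toPseudoRiemannianMetric
      𝓑₁.metric.toPseudoRiemannianMetric
      (Subtype.val : 𝓑₁.docOpens hF hP → 𝓑₁.carrier) := by
    refine ⟨contMDiff_subtype_val, fun x ↦ ?_⟩
    ext v w
    rw [pullbackBilin_apply, Literature.Geometry.Manifold.OpenSubmanifold.mfderiv_subtype_val]
    rfl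
  have hsymm : PseudoRiemannianMetric.IsIsometricImmersion
      (Kerr.smoothMetric M a (Kerr.rPlus M a)).toPseudoRiemannianMetric
      (𝓑₁.metric.restrict hres (𝓑₁.docOpens hF hP)).toPseudoRiemannianMetric Φ.symm := by
    refine ⟨Φ.symm.contMDiff, fun y ↦ ?_⟩
    have hcomp := pullbackBilin_comp (Φ.contMDiff.mdifferentiable (by simp))
      (Φ.symm.contMDiff.mdifferentiable (by simp))
      (Kerr.smoothMetric M a (Kerr.rPlus M a)).toPseudoRiemannianMetric.val
    have hid : ((Φ : 𝓑₁.docOpens hF hP → Kerr.exterior M a) ∘ Φ.symm) = id :=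
      funext fun x ↦ Φ.apply_symm_apply x
    have hΦ' := funext hΦ
    rw [hid, pullbackBilin_id] at hcomp
    have h1 : pullbackBilin (⇑Φ.symm)
        (𝓑₁.metric.restrict hres (𝓑₁.docOpens hF hP)).toPseudoRiemannianMetric.val =
        (Kerr.smoothMetric M a (Kerr.rPlus M a)).toPseudoRiemannianMetric.val := by
      rw [← hΦ']
      exact hcomp.symm
    exact congrFun h1 y
  have hsurj : Function.Surjective (Φ.symm : Kerr.exterior M a → 𝓑₁.docOpens hF hP) :=
    fun x ↦ ⟨Φ x, Φ.symm_apply_apply x⟩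
  refine ⟨M, a, hMa, Subtype.val ∘ Φ.symm, Subtype.val_injective.comp Φ.symm.injective, ?_,
    hincl.comp hsymm⟩
  rw [Set.range_comp, hsurj.range_eq, Set.image_univ]
  ext y
  simp only [Set.mem_range, Subtype.exists, exists_prop, exists_eq_right]
  rfl

/-- **The AIK/CC08 schema is FALSE without connectedness of the horizon.**  At the predicate
"`I⁺`-regular, analytic, non-degenerate horizon" (= the hypotheses of the vendored
`stationary_black_hole_uniqueness IsIPlusRegular`, Chruściel–Costa 2008 Thm. 1.3, with
`IsConnected 𝓑.horizon` deleted) the schema `AlexakisIonescuKlainermanRigidity` fails: Minkowski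
spacetime (`minkowskiBH`) satisfies the predicate (its horizon is EMPTY, so non-degeneracy is
vacuous) and is vacuum, but its d.o.c. `ℝ⁴` is not a sub-extremal Kerr exterior.
[cite: ChruscielCosta2008, Thm. 1.3 (hypotheses)] [cite: SbierskiJDG2018, Thm. 1] -/
theorem not_aik_regular_analytic_nondegenerate :
    ¬ AlexakisIonescuKlainermanRigidity.{0} fun 𝓑 ↦ 𝓑.IsIPlusRegular ∧ 𝓑.IsAnalytic ∧
      ∀ [𝓑.metric.HasLeviCivita], 𝓑.toSpacetime.IsNonDegenerateHorizon 𝓑.Mext := by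
  intro h
  haveI : Kerr.Facts := kerrFacts
  haveI : minkowskiBH.metric.HasLeviCivita :=
    minkowskiBH.metric.toPseudoRiemannianMetric.hasLeviCivita
  have hK := h minkowskiBH LorentzianMetric.isOpen_chronologicalFuture_holds_of_boundaryless
    LorentzianMetric.isOpen_chronologicalPast_holds_of_boundaryless
    PseudoRiemannianMetric.contMDiff_restrict_holds
    ⟨isIPlusRegular_minkowskiBH, isAnalytic_minkowskiBH, fun {_} ↦ h3_minkowskiBH⟩ h1_minkowskiBH
  exact not_kerrConclusion_minkowskiBH
    (kerrConclusion_of_isIsometricToKerrExterior minkowskiBH _ _ _ hK)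

/-- **Corollary: the schema at the bare predicate `IsIPlusRegular` is false** (the informal remark
of `StationaryBlackHoleUniqueness.lean`, now a theorem). [cite: ChruscielCosta2008, Def. 1.1 and p. 4] -/
theorem not_aik_isIPlusRegular :
    ¬ AlexakisIonescuKlainermanRigidity.{0} StationaryAFBlackHole.IsIPlusRegular :=
  fun h ↦ not_aik_regular_analytic_nondegenerate (h.mono fun _ h𝓑 ↦ h𝓑.1)

/-- **The vendored Chruściel–Costa schema needs its connectedness hypothesis**:
`stationary_black_hole_uniqueness IsIPlusRegular` with `IsConnected 𝓑.horizon` deleted (all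
other binders verbatim) is FALSE. [cite: ChruscielCosta2008, Thm. 1.3] -/
theorem not_uniqueness_without_connected_horizon :
    ¬ ∀ (𝓑 : StationaryAFBlackHole.{0}) [𝓑.metric.HasLeviCivita] [Kerr.Facts]
      (hF : 𝓑.metric.isOpen_chronologicalFuture 𝓑.timeOrientation)
      (hP : 𝓑.metric.isOpen_chronologicalPast 𝓑.timeOrientation)
      (hres : PseudoRiemannianMetric.contMDiff_restrict (I := 𝓡 4) (n := (∞ : ℕ∞ω))
        (M := 𝓑.carrier)),
      𝓑.IsIPlusRegular → 𝓑.IsAnalytic → 𝓑.metric.toPseudoRiemannianMetric.IsRicciFlat →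
      𝓑.toSpacetime.IsNonDegenerateHorizon 𝓑.Mext → 𝓑.IsIsometricToKerrExterior hF hP hres := by
  intro h
  apply not_aik_regular_analytic_nondegenerate
  intro 𝓑 _ _ hF hP hres hP𝓑 hvac
  exact h 𝓑 hF hP hres hP𝓑.1 hP𝓑.2.1 hvac hP𝓑.2.2

/-- For contrast: `minkowskiBH` does NOT satisfy `IsIPlusRegularNonDegenerate` (whose middle
clause `IsConnected 𝓑.horizon` forces a non-empty horizon) — the predicate at which the open
non-analytic uniqueness problem and the lines' stubs S2/S3 are posed is safe from this witness.
[cite: ChruscielCosta2008, Thm. 1.3 (hypotheses)] -/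
theorem not_isIPlusRegularNonDegenerate_minkowskiBH : ¬ minkowskiBH.IsIPlusRegularNonDegenerate := by
  intro h
  have hne := h.2.1.nonempty
  rw [horizon_minkowskiBH] at hne
  exact Set.not_nonempty_empty hne

end Summit.FinalStateConjecture.FinalStateConjecture.Theorems.ZeroEnergyRigidity.Negative

end
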